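import Mathlib
import Summits.ValiantsHypothesis.ValiantsHypothesis.Theorems.LacunarySymmetroidMatrixDescartesMonotoneExactEnds
import Summits.ValiantsHypothesis.ValiantsHypothesis.Theorems.LacunarySymmetroidMatrixDescartesTwoBlockLimit

/-!
# `MatrixDescartes` (stmt-ValiantsHypothesis-18050) — END INERTIAS OF AN ARBITRARY SIGNED WORD FROM GRAM DATA: at large
# scales `ν(F(x)) = ν(B) + π(Cᵤᵤ) − #{σᵤ > 0}`, at small scales `ν(F(x)) = ν(B) + π(Cₗₗ) − #{σₗ > 0}`, both ends
# non-singular — for ANY signs, whenever the upper / lower Gram block is non-singular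

HONEST FRAMING.  Cell `pub-symmetroid`, seat `val-sym-mdr-p2` (gen 21); helper file `--supports` the crux
`Theses.LacunarySymmetroid.MatrixDescartes` (OPEN), NO closure claim; companion of `…TwoBlockLimit` (the two-block limit
lemma: non-singular `C₁₁`, arbitrary signs), `…MonotoneExactEnds` (the MONOTONE case, where the Gram block may be singular)
and `…GramDualInertiaDuality` (`ν(F(x)) + #{σ>0} = ν(B) + π(𝔻(x))`).  STRUCTURE theorems for GENERAL (non-monotone)
two-sided signed words — the end data that the lineage's inertia calculus (window laws, index formula, parity law)
consumes, now available when the END LETTERS are degenerate (rank-one columns) but the MIDDLE letter is not; the drift /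
parity laws follow in `…DriftLaw`.  Nothing here bears on the crux in its window, `stub_twoSided`, `DoorA26` / `DoorA34`,
registers, or `VP ≠ VNP`.

SETTING.  `B` real symmetric, `det B ≠ 0`, exponent `e`; UPPER columns `Uᵤ` (signs `σᵤⱼ ≠ 0` ARBITRARY, exponents
`δᵤⱼ > e`), LOWER columns `Uₗ` (signs `σₗⱼ ≠ 0` arbitrary, exponents `δₗⱼ < e`); Gram blocks `Cᵤᵤ = UᵤᵀB⁻¹Uᵤ`,
`Cᵤₗ = UᵤᵀB⁻¹Uₗ`, `Cₗₗ = UₗᵀB⁻¹Uₗ`; word `F(x) = x^eB + U diag(σx^δ) Uᵀ`, dual `𝔻(x) = diag(σⱼ⁻¹x^{E−δⱼ}) + x^{E−e}UᵀB⁻¹U`.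

* `dual_fromCols_eq_smul_large'` / `dual_fromCols_swap_eq_smul_small'` — `𝔻(x) = x^{E−e}·M(1/x)` with `M` the family of
  `…TwoBlockLimit` on `(Cᵤᵤ, Cᵤₗ, Cₗₗ; σᵤ⁻¹, δᵤ − e; σₗ, e − δₗ)`, and, blocks swapped, `𝔻(x) = x^{E−e}·M′(x)` with `M′` on
  `(Cₗₗ, Cₗᵤ, Cᵤᵤ; σₗ⁻¹, e − δₗ; σᵤ, δᵤ − e)` (no sign hypotheses).
* `exists_posIndex_dual_large'` / `…_small'` — `π(𝔻(x)) = π(Cᵤᵤ) + #{σₗ > 0}` for `x ≥ N` (`det Cᵤᵤ ≠ 0`),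
  `π(𝔻(x)) = π(Cₗₗ) + #{σᵤ > 0}` for `x ∈ (0, ε)` (`det Cₗₗ ≠ 0`), `det 𝔻(x) ≠ 0` at both ends.
* **`exists_negIndex_word_large'` / `exists_negIndex_word_small'` (END INERTIAS FROM GRAM DATA).**  `det B ≠ 0`, all signs
  non-zero: if `det Cᵤᵤ ≠ 0` then `ν(F(x)) + #{σᵤ > 0} = ν(B) + π(Cᵤᵤ)` and `det F(x) ≠ 0` for all `x ≥ N`; if
  `det Cₗₗ ≠ 0` then `ν(F(x)) + #{σₗ > 0} = ν(B) + π(Cₗₗ)` and `det F(x) ≠ 0` for all `x ∈ (0, ε)`.  (Monotone check: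
  `σᵤ > 0`, `σₗ < 0` gives `ν(B) − ν(Cᵤᵤ)` and `ν(B) + π(Cₗₗ)`, the values of `…MonotoneExactEnds`.)  The INERTIA DRIFT of
  an arbitrary word across `(0, ∞)` is therefore `Δ = (π(Cₗₗ) − #{σₗ>0}) − (π(Cᵤᵤ) − #{σᵤ>0})` — a Gram-block quantity.

[folklore] (Sylvester's law of inertia; Sylvester's determinant identity).  Axioms `propext`, `Classical.choice`,
`Quot.sound`.  No definitions.
-/

-- layout Summits/ValiantsHypothesis/ValiantsHypothesis forces the duplicated namespace component
set_option linter.dupNamespace false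

namespace Summit.ValiantsHypothesis.ValiantsHypothesis.Theorems.LacunarySymmetroidMatrixDescartes

open Polynomial Matrix Finset
open scoped BigOperators Topology

namespace GramDual

section EndInertia

variable {ι ρ ρᵤ ρₗ : Type} [Fintype ι] [DecidableEq ι] [Fintype ρ] [DecidableEq ρ] [Fintype ρᵤ] [DecidableEq ρᵤ]
  [Fintype ρₗ] [DecidableEq ρₗ]

/-- the two-block family of `…TwoBlockLimit` (file-local notation) -/
local notation3 (prettyPrint := false) "𝕄'[" C₁₁ ", " C₁₂ ", " C₂₂ ", " α ", " p ", " β ", " q ", " s "]" =>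
  Matrix.fromBlocks ((C₁₁ : Matrix _ _ ℝ) + Matrix.diagonal (fun j => (α : _ → ℝ) j * (s : ℝ) ^ ((p : _ → ℕ) j)))
    (C₁₂ : Matrix _ _ ℝ) (C₁₂)ᵀ
    ((C₂₂ : Matrix _ _ ℝ) + Matrix.diagonal (fun j => ((β : _ → ℝ) j * (s : ℝ) ^ ((q : _ → ℕ) j))⁻¹))

/-! ## §1  The dual of an arbitrary two-sided word at both ends, in two-block form -/

omit [Fintype ρ] in
/-- Lower columns at large scales: `diag(σ⁻¹x^{E−δ}) + x^{E−e}C = x^{E−e}·(C + diag((σ·x⁻¹^{e−δ})⁻¹))` (`δ < e ≤ E`).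
[folklore] -/
theorem lowerDual_eq_smul_large' (C : Matrix ρ ρ ℝ) (σ : ρ → ℝ) (E e : ℕ) (δ : ρ → ℕ) (hδ : ∀ j, δ j < e)
    (he : e ≤ E) (x : ℝ) :
    Matrix.diagonal (fun j => (σ j)⁻¹ * x ^ (E - δ j)) + x ^ (E - e) • C
      = x ^ (E - e) • (C + Matrix.diagonal (fun j => (σ j * x⁻¹ ^ (e - δ j))⁻¹)) := by
  ext i j
  simp only [Matrix.add_apply, Matrix.smul_apply, Matrix.diagonal_apply, smul_eq_mul]
  split_ifs with h
  · subst h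
    have hk : E - δ i = (E - e) + (e - δ i) := by have := hδ i; omega
    rw [hk, pow_add, mul_inv, inv_pow, inv_inv]
    ring
  · ring

omit [Fintype ρ] in
/-- Lower columns at small scales: `diag(σ⁻¹x^{E−δ}) + x^{E−e}C = x^{E−e}·(C + diag(σ⁻¹x^{e−δ}))` (`δ < e ≤ E`). [folklore] -/
theorem lowerDual_eq_smul_small' (C : Matrix ρ ρ ℝ) (σ : ρ → ℝ) (E e : ℕ) (δ : ρ → ℕ) (hδ : ∀ j, δ j < e)
    (he : e ≤ E) (x : ℝ) :
    Matrix.diagonal (fun j => (σ j)⁻¹ * x ^ (E - δ j)) + x ^ (E - e) • C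
      = x ^ (E - e) • (C + Matrix.diagonal (fun j => (σ j)⁻¹ * x ^ (e - δ j))) := by
  ext i j
  simp only [Matrix.add_apply, Matrix.smul_apply, Matrix.diagonal_apply, smul_eq_mul]
  split_ifs with h
  · subst h
    have hk : E - δ i = (E - e) + (e - δ i) := by have := hδ i; omega
    rw [hk, pow_add]
    ring
  · ring

omit [Fintype ρ] in
/-- Upper columns at small scales: `diag(σ⁻¹x^{E−δ}) + x^{E−e}C = x^{E−e}·(C + diag((σ·x^{δ−e})⁻¹))` (`e < δ ≤ E`,
`x ≠ 0`). [folklore] -/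
theorem upperDual_eq_smul_small' (C : Matrix ρ ρ ℝ) (σ : ρ → ℝ) (E e : ℕ) (δ : ρ → ℕ) (hδ : ∀ j, e < δ j)
    (hδE : ∀ j, δ j ≤ E) {x : ℝ} (hx : x ≠ 0) :
    Matrix.diagonal (fun j => (σ j)⁻¹ * x ^ (E - δ j)) + x ^ (E - e) • C
      = x ^ (E - e) • (C + Matrix.diagonal (fun j => (σ j * x ^ (δ j - e))⁻¹)) := by
  ext i j
  simp only [Matrix.add_apply, Matrix.smul_apply, Matrix.diagonal_apply, smul_eq_mul]
  split_ifs with h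
  · subst h
    have hk : E - e = (E - δ i) + (δ i - e) := by have := hδ i; have := hδE i; omega
    have hxp : x ^ (δ i - e) ≠ 0 := pow_ne_zero _ hx
    rw [hk, pow_add, mul_inv]
    field_simp
    ring
  · ring

omit [Fintype ρᵤ] [Fintype ρₗ] in
/-- **The dual at LARGE scales is `x^{E−e}·M(1/x)`**, `M` the two-block family of `…TwoBlockLimit` on
`(Cᵤᵤ, Cᵤₗ, Cₗₗ; σᵤ⁻¹, δᵤ − e; σₗ, e − δₗ)` — ARBITRARY signs. [folklore] -/
theorem dual_fromCols_eq_smul_large' {B : Matrix ι ι ℝ} (hBs : B.IsSymm) (Uᵤ : Matrix ι ρᵤ ℝ) (Uₗ : Matrix ι ρₗ ℝ)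
    (σᵤ : ρᵤ → ℝ) (σₗ : ρₗ → ℝ) (E e : ℕ) (δᵤ : ρᵤ → ℕ) (δₗ : ρₗ → ℕ) (hδᵤ : ∀ j, e < δᵤ j)
    (hδᵤE : ∀ j, δᵤ j ≤ E) (hδₗ : ∀ j, δₗ j < e) (he : e ≤ E) {x : ℝ} (hx : 0 < x) :
    Matrix.diagonal (fun j => (Sum.elim σᵤ σₗ j)⁻¹ * x ^ (E - Sum.elim δᵤ δₗ j))
        + x ^ (E - e) • ((Matrix.fromCols Uᵤ Uₗ)ᵀ * B⁻¹ * Matrix.fromCols Uᵤ Uₗ)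
      = x ^ (E - e) • 𝕄'[Uᵤᵀ * B⁻¹ * Uᵤ, Uᵤᵀ * B⁻¹ * Uₗ, Uₗᵀ * B⁻¹ * Uₗ, (fun j => (σᵤ j)⁻¹),
          (fun j => δᵤ j - e), σₗ, (fun j => e - δₗ j), x⁻¹] := by
  rw [eval_dual_fromCols B Uᵤ Uₗ σᵤ σₗ E e δᵤ δₗ hBs x, Matrix.fromBlocks_smul, Matrix.fromBlocks_inj]
  refine ⟨?_, rfl, ?_, ?_⟩
  · rw [dual_eq_smul_rescaledDual _ σᵤ E e δᵤ hδᵤ hδᵤE hx.ne', add_comm]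
  · rw [Matrix.transpose_smul, transpose_gram_cross B Uᵤ Uₗ hBs]
  · exact lowerDual_eq_smul_large' _ σₗ E e δₗ hδₗ he x

omit [Fintype ρᵤ] [Fintype ρₗ] in
/-- **The dual at SMALL scales, block-swapped, is `x^{E−e}·M′(x)`**, `M′` the family on
`(Cₗₗ, Cₗᵤ, Cᵤᵤ; σₗ⁻¹, e − δₗ; σᵤ, δᵤ − e)`. [folklore] -/
theorem dual_fromCols_swap_eq_smul_small' {B : Matrix ι ι ℝ} (hBs : B.IsSymm) (Uᵤ : Matrix ι ρᵤ ℝ)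
    (Uₗ : Matrix ι ρₗ ℝ) (σᵤ : ρᵤ → ℝ) (σₗ : ρₗ → ℝ) (E e : ℕ) (δᵤ : ρᵤ → ℕ) (δₗ : ρₗ → ℕ)
    (hδᵤ : ∀ j, e < δᵤ j) (hδᵤE : ∀ j, δᵤ j ≤ E) (hδₗ : ∀ j, δₗ j < e) (he : e ≤ E) {x : ℝ} (hx : 0 < x) :
    (Matrix.diagonal (fun j => (Sum.elim σᵤ σₗ j)⁻¹ * x ^ (E - Sum.elim δᵤ δₗ j))
        + x ^ (E - e) • ((Matrix.fromCols Uᵤ Uₗ)ᵀ * B⁻¹ * Matrix.fromCols Uᵤ Uₗ)).submatrix Sum.swap Sum.swap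
      = x ^ (E - e) • 𝕄'[Uₗᵀ * B⁻¹ * Uₗ, Uₗᵀ * B⁻¹ * Uᵤ, Uᵤᵀ * B⁻¹ * Uᵤ, (fun j => (σₗ j)⁻¹),
          (fun j => e - δₗ j), σᵤ, (fun j => δᵤ j - e), x] := by
  rw [eval_dual_fromCols B Uᵤ Uₗ σᵤ σₗ E e δᵤ δₗ hBs x, Matrix.fromBlocks_submatrix_sum_swap_sum_swap,
    Matrix.fromBlocks_smul, Matrix.fromBlocks_inj]
  refine ⟨?_, ?_, ?_, ?_⟩
  · exact lowerDual_eq_smul_small' _ σₗ E e δₗ hδₗ he x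
  · rw [Matrix.transpose_smul, transpose_gram_cross B Uᵤ Uₗ hBs]
  · rw [transpose_gram_cross B Uₗ Uᵤ hBs]
  · exact upperDual_eq_smul_small' _ σᵤ E e δᵤ hδᵤ hδᵤE hx.ne'

/-! ## §2  End inertias of the dual -/

/-- `A` block-swapped equals `c • M` with `c > 0` ⇒ `π(A) = π(M)`. [folklore] -/
theorem posIndex_eq_of_swap_eq_smul {A : Matrix (ρᵤ ⊕ ρₗ) (ρᵤ ⊕ ρₗ) ℝ} {M : Matrix (ρₗ ⊕ ρᵤ) (ρₗ ⊕ ρᵤ) ℝ}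
    (hA : A.IsHermitian) (hM : M.IsHermitian) {c : ℝ} (hc : 0 < c) (h : A.submatrix Sum.swap Sum.swap = c • M) :
    Fintype.card {j // 0 < hA.eigenvalues j} = Fintype.card {j // 0 < hM.eigenvalues j} := by
  have hAs : (A.submatrix Sum.swap Sum.swap).IsHermitian := hA.submatrix _
  rw [← posIndex_submatrix_swap hA hAs]
  exact posIndex_eq_of_eq_smul hAs hM hc h

omit [Fintype ι] [DecidableEq ι] [DecidableEq ρᵤ] [DecidableEq ρₗ] in
/-- `#{j : 0 < σⱼ}` over a juxtaposition splits. [folklore] -/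
theorem card_pos_sumElim' (σᵤ : ρᵤ → ℝ) (σₗ : ρₗ → ℝ) :
    Fintype.card {j // 0 < Sum.elim σᵤ σₗ j} = Fintype.card {j // 0 < σᵤ j} + Fintype.card {j // 0 < σₗ j} := by
  classical
  rw [card_subtype_sum (fun j => 0 < Sum.elim σᵤ σₗ j)]
  simp only [Sum.elim_inl, Sum.elim_inr]
  rfl

/-- **The dual at LARGE scales** (arbitrary signs, `det Cᵤᵤ ≠ 0`): `π(𝔻(x)) = π(Cᵤᵤ) + #{σₗ > 0}` and `det 𝔻(x) ≠ 0`
for all `x ≥ N`. [folklore] -/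
theorem exists_posIndex_dual_large' {B : Matrix ι ι ℝ} (hBs : B.IsSymm) (Uᵤ : Matrix ι ρᵤ ℝ) (Uₗ : Matrix ι ρₗ ℝ)
    {σᵤ : ρᵤ → ℝ} {σₗ : ρₗ → ℝ} (hσₗ : ∀ j, σₗ j ≠ 0) (E e : ℕ) {δᵤ : ρᵤ → ℕ} {δₗ : ρₗ → ℕ} (hδᵤ : ∀ j, e < δᵤ j)
    (hδᵤE : ∀ j, δᵤ j ≤ E) (hδₗ : ∀ j, δₗ j < e) (he : e ≤ E) (hCᵤu : IsUnit (Uᵤᵀ * B⁻¹ * Uᵤ).det)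
    (hCᵤ : (Uᵤᵀ * B⁻¹ * Uᵤ).IsHermitian) :
    ∃ N : ℝ, 0 < N ∧ ∀ x : ℝ, N ≤ x →
      Fintype.card {j // 0 < (isHermitian_eval_dual hBs (Matrix.fromCols Uᵤ Uₗ) (Sum.elim σᵤ σₗ) E e
            (Sum.elim δᵤ δₗ) x).eigenvalues j} = Fintype.card {j // 0 < hCᵤ.eigenvalues j} + Fintype.card {j // 0 < σₗ j}
        ∧ (Matrix.diagonal (fun j => (Sum.elim σᵤ σₗ j)⁻¹ * x ^ (E - Sum.elim δᵤ δₗ j))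
            + x ^ (E - e) • ((Matrix.fromCols Uᵤ Uₗ)ᵀ * B⁻¹ * Matrix.fromCols Uᵤ Uₗ)).det ≠ 0 := by
  classical
  obtain ⟨ε, hε, hε'⟩ := Inertia.inertia_twoBlock' (isSymm_gram hBs Uᵤ) (isSymm_gram hBs Uₗ) (Uᵤᵀ * B⁻¹ * Uₗ)
    (fun j => (σᵤ j)⁻¹) (p := fun j => δᵤ j - e) (β := σₗ) (q := fun j => e - δₗ j) hCᵤu hσₗ
    (fun j => by have := hδᵤ j; omega) (fun j => by have := hδₗ j; omega) hCᵤ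
  refine ⟨ε⁻¹ + 1, by positivity, fun x hx => ?_⟩
  have hxpos : 0 < x := lt_of_lt_of_le (by positivity) hx
  have hxinv : x⁻¹ < ε := by
    calc x⁻¹ ≤ (ε⁻¹ + 1)⁻¹ := inv_anti₀ (by positivity) hx
      _ < (ε⁻¹)⁻¹ := inv_strictAnti₀ (by positivity) (lt_add_one _)
      _ = ε := inv_inv ε
  obtain ⟨-, hπ, hdet⟩ := hε' x⁻¹ (inv_pos.2 hxpos) hxinv
  have heq := dual_fromCols_eq_smul_large' hBs Uᵤ Uₗ σᵤ σₗ E e δᵤ δₗ hδᵤ hδᵤE hδₗ he hxpos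
  have hM := Inertia.isHermitian_twoBlock' (isSymm_gram hBs Uᵤ) (isSymm_gram hBs Uₗ) (Uᵤᵀ * B⁻¹ * Uₗ)
    (fun j => (σᵤ j)⁻¹) (fun j => δᵤ j - e) σₗ (fun j => e - δₗ j) x⁻¹
  refine ⟨?_, ?_⟩
  · rw [posIndex_eq_of_eq_smul (isHermitian_eval_dual hBs _ _ E e _ x) hM (pow_pos hxpos _) heq]
    exact hπ
  · rw [heq, Matrix.det_smul]
    exact mul_ne_zero (pow_ne_zero _ (pow_ne_zero _ hxpos.ne')) hdet

/-- **The dual at SMALL scales** (arbitrary signs, `det Cₗₗ ≠ 0`): `π(𝔻(x)) = π(Cₗₗ) + #{σᵤ > 0}` and `det 𝔻(x) ≠ 0`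
for all `x ∈ (0, ε)`. [folklore] -/
theorem exists_posIndex_dual_small' {B : Matrix ι ι ℝ} (hBs : B.IsSymm) (Uᵤ : Matrix ι ρᵤ ℝ) (Uₗ : Matrix ι ρₗ ℝ)
    {σᵤ : ρᵤ → ℝ} {σₗ : ρₗ → ℝ} (hσᵤ : ∀ j, σᵤ j ≠ 0) (E e : ℕ) {δᵤ : ρᵤ → ℕ} {δₗ : ρₗ → ℕ} (hδᵤ : ∀ j, e < δᵤ j)
    (hδᵤE : ∀ j, δᵤ j ≤ E) (hδₗ : ∀ j, δₗ j < e) (he : e ≤ E) (hCₗu : IsUnit (Uₗᵀ * B⁻¹ * Uₗ).det)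
    (hCₗ : (Uₗᵀ * B⁻¹ * Uₗ).IsHermitian) :
    ∃ ε : ℝ, 0 < ε ∧ ∀ x : ℝ, 0 < x → x < ε →
      Fintype.card {j // 0 < (isHermitian_eval_dual hBs (Matrix.fromCols Uᵤ Uₗ) (Sum.elim σᵤ σₗ) E e
            (Sum.elim δᵤ δₗ) x).eigenvalues j} = Fintype.card {j // 0 < hCₗ.eigenvalues j} + Fintype.card {j // 0 < σᵤ j}
        ∧ (Matrix.diagonal (fun j => (Sum.elim σᵤ σₗ j)⁻¹ * x ^ (E - Sum.elim δᵤ δₗ j))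
            + x ^ (E - e) • ((Matrix.fromCols Uᵤ Uₗ)ᵀ * B⁻¹ * Matrix.fromCols Uᵤ Uₗ)).det ≠ 0 := by
  classical
  obtain ⟨ε, hε, hε'⟩ := Inertia.inertia_twoBlock' (isSymm_gram hBs Uₗ) (isSymm_gram hBs Uᵤ) (Uₗᵀ * B⁻¹ * Uᵤ)
    (fun j => (σₗ j)⁻¹) (p := fun j => e - δₗ j) (β := σᵤ) (q := fun j => δᵤ j - e) hCₗu hσᵤ
    (fun j => by have := hδₗ j; omega) (fun j => by have := hδᵤ j; omega) hCₗ
  refine ⟨ε, hε, fun x hx hxε => ?_⟩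
  obtain ⟨-, hπ, hdet⟩ := hε' x hx hxε
  have heq := dual_fromCols_swap_eq_smul_small' hBs Uᵤ Uₗ σᵤ σₗ E e δᵤ δₗ hδᵤ hδᵤE hδₗ he hx
  have hM := Inertia.isHermitian_twoBlock' (isSymm_gram hBs Uₗ) (isSymm_gram hBs Uᵤ) (Uₗᵀ * B⁻¹ * Uᵤ)
    (fun j => (σₗ j)⁻¹) (fun j => e - δₗ j) σᵤ (fun j => δᵤ j - e) x
  refine ⟨?_, ?_⟩
  · rw [posIndex_eq_of_swap_eq_smul (isHermitian_eval_dual hBs _ _ E e _ x) hM (pow_pos hx _) heq]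
    exact hπ
  · intro h0
    apply hdet
    have h1 := Matrix.det_submatrix_equiv_self (Equiv.sumComm ρₗ ρᵤ)
      (Matrix.diagonal (fun j => (Sum.elim σᵤ σₗ j)⁻¹ * x ^ (E - Sum.elim δᵤ δₗ j))
        + x ^ (E - e) • ((Matrix.fromCols Uᵤ Uₗ)ᵀ * B⁻¹ * Matrix.fromCols Uᵤ Uₗ))
    rw [h0] at h1
    have h2 : ((Matrix.diagonal (fun j => (Sum.elim σᵤ σₗ j)⁻¹ * x ^ (E - Sum.elim δᵤ δₗ j))
        + x ^ (E - e) • ((Matrix.fromCols Uᵤ Uₗ)ᵀ * B⁻¹ * Matrix.fromCols Uᵤ Uₗ)).submatrix Sum.swap Sum.swap).det = 0 :=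
      h1
    rw [heq, Matrix.det_smul] at h2
    exact (mul_eq_zero.1 h2).resolve_left (pow_ne_zero _ (pow_ne_zero _ hx.ne'))

/-! ## §3  END INERTIAS OF AN ARBITRARY SIGNED WORD FROM GRAM DATA -/

/-- **The word at LARGE scales** (arbitrary signs; `det B ≠ 0`, `det Cᵤᵤ ≠ 0`): for `x ≥ N`,
`ν(F(x)) + #{σᵤ > 0} = ν(B) + π(Cᵤᵤ)` and `det F(x) ≠ 0`. [folklore] -/
theorem exists_negIndex_word_large' {B : Matrix ι ι ℝ} (hBs : B.IsSymm) (hBu : IsUnit B.det) (Uᵤ : Matrix ι ρᵤ ℝ)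
    (Uₗ : Matrix ι ρₗ ℝ) {σᵤ : ρᵤ → ℝ} {σₗ : ρₗ → ℝ} (hσᵤ : ∀ j, σᵤ j ≠ 0) (hσₗ : ∀ j, σₗ j ≠ 0) (e : ℕ)
    {δᵤ : ρᵤ → ℕ} {δₗ : ρₗ → ℕ} (hδᵤ : ∀ j, e < δᵤ j) (hδₗ : ∀ j, δₗ j < e) (hB : B.IsHermitian)
    (hCᵤu : IsUnit (Uᵤᵀ * B⁻¹ * Uᵤ).det) (hCᵤ : (Uᵤᵀ * B⁻¹ * Uᵤ).IsHermitian) :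
    ∃ N : ℝ, 0 < N ∧ ∀ x : ℝ, N ≤ x →
      Fintype.card {j // (isHermitian_eval_word hBs (Matrix.fromCols Uᵤ Uₗ) (Sum.elim σᵤ σₗ) e
            (Sum.elim δᵤ δₗ) x).eigenvalues j < 0} + Fintype.card {j // 0 < σᵤ j}
          = Fintype.card {j // hB.eigenvalues j < 0} + Fintype.card {j // 0 < hCᵤ.eigenvalues j}
        ∧ (x ^ e • B + Matrix.fromCols Uᵤ Uₗ
            * Matrix.diagonal (fun j => Sum.elim σᵤ σₗ j * x ^ (Sum.elim δᵤ δₗ j)) * (Matrix.fromCols Uᵤ Uₗ)ᵀ).det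
              ≠ 0 := by
  classical
  obtain ⟨E, he, hδE⟩ := exists_bound e (Sum.elim δᵤ δₗ)
  have hδᵤE : ∀ j, δᵤ j ≤ E := fun j => hδE (Sum.inl j)
  obtain ⟨N, hN, hN'⟩ := exists_posIndex_dual_large' hBs Uᵤ Uₗ hσₗ E e hδᵤ hδᵤE hδₗ he hCᵤu hCᵤ
  refine ⟨N, hN, fun x hx => ?_⟩
  have hxpos : 0 < x := lt_of_lt_of_le hN hx
  obtain ⟨hπ, hdet⟩ := hN' x hx
  have hσ : ∀ j, Sum.elim σᵤ σₗ j ≠ 0 := fun j => by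
    cases j with
    | inl j => exact hσᵤ j
    | inr j => exact hσₗ j
  have hF := isHermitian_eval_word hBs (Matrix.fromCols Uᵤ Uₗ) (Sum.elim σᵤ σₗ) e (Sum.elim δᵤ δₗ) x
  have hD := isHermitian_eval_dual hBs (Matrix.fromCols Uᵤ Uₗ) (Sum.elim σᵤ σₗ) E e (Sum.elim δᵤ δₗ) x
  have hdual := negIndex_word_add_eq hBs hBu (Matrix.fromCols Uᵤ Uₗ) (Sum.elim σᵤ σₗ) hσ e E (Sum.elim δᵤ δₗ)
    he hδE hxpos hB hF hD
  rw [card_pos_sumElim' σᵤ σₗ] at hdual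
  refine ⟨by omega, fun hF0 => ?_⟩
  have h := det_base_mul_eq B hBu (Matrix.fromCols Uᵤ Uₗ) (Sum.elim σᵤ σₗ) hσ e E (Sum.elim δᵤ δₗ) he hδE
    hxpos.ne'
  rw [hF0, mul_zero] at h
  exact mul_ne_zero (mul_ne_zero (mul_ne_zero hBu.ne_zero (Finset.prod_ne_zero_iff.2 fun j _ => hσ j))
    (pow_ne_zero _ hxpos.ne')) hdet h.symm

/-- **The word at SMALL scales** (arbitrary signs; `det B ≠ 0`, `det Cₗₗ ≠ 0`): for `x ∈ (0, ε)`,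
`ν(F(x)) + #{σₗ > 0} = ν(B) + π(Cₗₗ)` and `det F(x) ≠ 0`. [folklore] -/
theorem exists_negIndex_word_small' {B : Matrix ι ι ℝ} (hBs : B.IsSymm) (hBu : IsUnit B.det) (Uᵤ : Matrix ι ρᵤ ℝ)
    (Uₗ : Matrix ι ρₗ ℝ) {σᵤ : ρᵤ → ℝ} {σₗ : ρₗ → ℝ} (hσᵤ : ∀ j, σᵤ j ≠ 0) (hσₗ : ∀ j, σₗ j ≠ 0) (e : ℕ)
    {δᵤ : ρᵤ → ℕ} {δₗ : ρₗ → ℕ} (hδᵤ : ∀ j, e < δᵤ j) (hδₗ : ∀ j, δₗ j < e) (hB : B.IsHermitian)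
    (hCₗu : IsUnit (Uₗᵀ * B⁻¹ * Uₗ).det) (hCₗ : (Uₗᵀ * B⁻¹ * Uₗ).IsHermitian) :
    ∃ ε : ℝ, 0 < ε ∧ ∀ x : ℝ, 0 < x → x < ε →
      Fintype.card {j // (isHermitian_eval_word hBs (Matrix.fromCols Uᵤ Uₗ) (Sum.elim σᵤ σₗ) e
            (Sum.elim δᵤ δₗ) x).eigenvalues j < 0} + Fintype.card {j // 0 < σₗ j}
          = Fintype.card {j // hB.eigenvalues j < 0} + Fintype.card {j // 0 < hCₗ.eigenvalues j}
        ∧ (x ^ e • B + Matrix.fromCols Uᵤ Uₗ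
            * Matrix.diagonal (fun j => Sum.elim σᵤ σₗ j * x ^ (Sum.elim δᵤ δₗ j)) * (Matrix.fromCols Uᵤ Uₗ)ᵀ).det
              ≠ 0 := by
  classical
  obtain ⟨E, he, hδE⟩ := exists_bound e (Sum.elim δᵤ δₗ)
  have hδᵤE : ∀ j, δᵤ j ≤ E := fun j => hδE (Sum.inl j)
  obtain ⟨ε, hε, hε'⟩ := exists_posIndex_dual_small' hBs Uᵤ Uₗ hσᵤ E e hδᵤ hδᵤE hδₗ he hCₗu hCₗ
  refine ⟨ε, hε, fun x hx hxε => ?_⟩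
  obtain ⟨hπ, hdet⟩ := hε' x hx hxε
  have hσ : ∀ j, Sum.elim σᵤ σₗ j ≠ 0 := fun j => by
    cases j with
    | inl j => exact hσᵤ j
    | inr j => exact hσₗ j
  have hF := isHermitian_eval_word hBs (Matrix.fromCols Uᵤ Uₗ) (Sum.elim σᵤ σₗ) e (Sum.elim δᵤ δₗ) x
  have hD := isHermitian_eval_dual hBs (Matrix.fromCols Uᵤ Uₗ) (Sum.elim σᵤ σₗ) E e (Sum.elim δᵤ δₗ) x
  have hdual := negIndex_word_add_eq hBs hBu (Matrix.fromCols Uᵤ Uₗ) (Sum.elim σᵤ σₗ) hσ e E (Sum.elim δᵤ δₗ)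
    he hδE hx hB hF hD
  rw [card_pos_sumElim' σᵤ σₗ] at hdual
  refine ⟨by omega, fun hF0 => ?_⟩
  have h := det_base_mul_eq B hBu (Matrix.fromCols Uᵤ Uₗ) (Sum.elim σᵤ σₗ) hσ e E (Sum.elim δᵤ δₗ) he hδE hx.ne'
  rw [hF0, mul_zero] at h
  exact mul_ne_zero (mul_ne_zero (mul_ne_zero hBu.ne_zero (Finset.prod_ne_zero_iff.2 fun j _ => hσ j))
    (pow_ne_zero _ hx.ne')) hdet h.symm

end EndInertia

end GramDual

end Summit.ValiantsHypothesis.ValiantsHypothesis.Theorems.LacunarySymmetroidMatrixDescartes
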